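import Mathlib
import Literature.Analysis.FunctionSpaces.TorusScalarFourierSeries
import HarnessLib

/-!
# A NUMERIC bound for the lattice constant of the Fourier-tail estimates: `Σ_{j∈ℤ} (1+j²)⁻¹ ≤ 9/2`, `Σ_{k∈ℤ²} ∏ᵢ (1+kᵢ²)⁻¹ ≤ 81/4`

Topic `Analysis/FunctionSpaces` (torus Fourier series).  The decay-of-coefficients / aliasing-tail bounds of the tree
(`Literature.Analysis.Fourier.TorusFourierTailSmooth.tsum_tail_norm_mFourierCoeff_le[_mul_weight_le]`, and their consumers in the Hubbard
`KLProgramme` — the `(A)` capstone's alias Bell constants and the `(B)` door's aliasing terms) carry the lattice constant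
`C_d = Σ_{k ∈ ℤ^d} ∏ᵢ (1 + kᵢ²)⁻¹` symbolically (only its summability, `Torus.summable_pi_prod_weight`, is in the tree).  For `d = 2` this file gives
the NUMBER a closer needs:

* `tsum_inv_one_add_sq_nat_le` — `Σ_{n∈ℕ} (1+n²)⁻¹ ≤ 1 + π²/6` (comparison with `ζ(2)`, Mathlib's `hasSum_zeta_two`, plus the term `n = 0`);
* `tsum_inv_one_add_sq_nat_succ_le` — `Σ_{n∈ℕ} (1+(n+1)²)⁻¹ ≤ π²/6`;
* `tsum_inv_one_add_sq_int_le` — `Σ_{j∈ℤ} (1+j²)⁻¹ ≤ 9/2` (`1 + π²/3 < 4.31`);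
* `tsum_prod_inv_one_add_sq_fin_two_eq` — `Σ_{k : Fin 2 → ℤ} ∏ᵢ (1+kᵢ²)⁻¹ = (Σ_{j∈ℤ} (1+j²)⁻¹)²`;
* **`tsum_prod_inv_one_add_sq_fin_two_le`** — `Σ_{k : Fin 2 → ℤ} ∏ᵢ (1+kᵢ²)⁻¹ ≤ 81/4`.

Everything is proved; no definitions.  (The exact value is `(π coth π)² ≈ 9.94`; `81/4` is what the elementary comparison gives.)

## References

* L. Grafakos, *Classical Fourier Analysis*, 3rd ed., GTM 249 (Springer 2014), §3.3.3 (decay of Fourier coefficients of smooth functions on the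
  torus; the lattice sums `Σ (1+|k|²)^{-s}`).
-/

noncomputable section

open Finset Real

namespace Literature.Analysis.FunctionSpaces

namespace Torus

/-- `Σ_{n∈ℕ} (1+n²)⁻¹ ≤ 1 + π²/6` (the `n = 0` term plus `ζ(2)`). [cite: Grafakos2014, §3.3.3] -/
theorem tsum_inv_one_add_sq_nat_le : ∑' n : ℕ, (1 + (n : ℝ) ^ 2)⁻¹ ≤ 1 + π ^ 2 / 6 := by
  have h1 : HasSum (fun n : ℕ => 1 / (n : ℝ) ^ 2) (π ^ 2 / 6) := hasSum_zeta_two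
  have h0 : HasSum (fun n : ℕ => if n = 0 then (1 : ℝ) else 0) 1 := hasSum_ite_eq 0 1
  have hle : ∀ n : ℕ, (1 + (n : ℝ) ^ 2)⁻¹ ≤ 1 / (n : ℝ) ^ 2 + (if n = 0 then (1 : ℝ) else 0) := by
    intro n
    rcases Nat.eq_zero_or_pos n with rfl | hn
    · simp
    · rw [if_neg (by omega), add_zero, inv_eq_one_div]
      have hn' : (0 : ℝ) < (n : ℝ) ^ 2 := by positivity
      exact one_div_le_one_div_of_le hn' (by linarith)
  have hs : Summable fun n : ℕ => (1 + (n : ℝ) ^ 2)⁻¹ :=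
    Summable.of_nonneg_of_le (fun n => by positivity) hle (h1.summable.add h0.summable)
  calc ∑' n : ℕ, (1 + (n : ℝ) ^ 2)⁻¹ ≤ ∑' n : ℕ, (1 / (n : ℝ) ^ 2 + (if n = 0 then (1 : ℝ) else 0)) :=
        Summable.tsum_le_tsum hle hs (h1.summable.add h0.summable)
    _ = π ^ 2 / 6 + 1 := by rw [(h1.add h0).tsum_eq]
    _ = 1 + π ^ 2 / 6 := by ring

/-- `Σ_{n∈ℕ} (1+(n+1)²)⁻¹ ≤ π²/6`. [cite: Grafakos2014, §3.3.3] -/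
theorem tsum_inv_one_add_sq_nat_succ_le : ∑' n : ℕ, (1 + ((n : ℝ) + 1) ^ 2)⁻¹ ≤ π ^ 2 / 6 := by
  have h1 : HasSum (fun n : ℕ => 1 / (n : ℝ) ^ 2) (π ^ 2 / 6) := hasSum_zeta_two
  -- the shifted zeta series
  have h1' : HasSum (fun n : ℕ => 1 / ((n : ℝ) + 1) ^ 2) (π ^ 2 / 6) := by
    have h := (hasSum_nat_add_iff' 1).2 h1
    simp only [range_one, sum_singleton, Nat.cast_zero, ne_eq, OfNat.ofNat_ne_zero, not_false_eq_true, zero_pow, div_zero,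
      sub_zero, Nat.cast_add, Nat.cast_one] at h
    exact h
  have hle : ∀ n : ℕ, (1 + ((n : ℝ) + 1) ^ 2)⁻¹ ≤ 1 / ((n : ℝ) + 1) ^ 2 := by
    intro n
    rw [inv_eq_one_div]
    exact one_div_le_one_div_of_le (by positivity) (by linarith)
  have hs : Summable fun n : ℕ => (1 + ((n : ℝ) + 1) ^ 2)⁻¹ :=
    Summable.of_nonneg_of_le (fun n => by positivity) hle h1'.summable
  calc ∑' n : ℕ, (1 + ((n : ℝ) + 1) ^ 2)⁻¹ ≤ ∑' n : ℕ, 1 / ((n : ℝ) + 1) ^ 2 := Summable.tsum_le_tsum hle hs h1'.summable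
    _ = π ^ 2 / 6 := h1'.tsum_eq

/-- **`Σ_{j∈ℤ} (1+j²)⁻¹ ≤ 9/2`** (`= 1 + 2Σ_{n≥1}(1+n²)⁻¹ ≤ 1 + π²/3 < 4.31`). [cite: Grafakos2014, §3.3.3] -/
theorem tsum_inv_one_add_sq_int_le : ∑' j : ℤ, (1 + (j : ℝ) ^ 2)⁻¹ ≤ 9 / 2 := by
  set f : ℤ → ℝ := fun j => (1 + (j : ℝ) ^ 2)⁻¹ with hf
  have hs : Summable f := summable_inv_one_add_sq_int
  have hsn : Summable fun n : ℕ => f n := hs.comp_injective Nat.cast_injective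
  have hinj : Function.Injective fun n : ℕ => (-((n : ℤ) + 1) : ℤ) := by
    intro a b h
    have h' : (a : ℤ) + 1 = (b : ℤ) + 1 := neg_injective h
    exact_mod_cast add_right_cancel h'
  have hsm : Summable fun n : ℕ => f (-((n : ℤ) + 1)) := hs.comp_injective hinj
  rw [tsum_of_nat_of_neg_add_one hsn hsm]
  have hA : ∑' n : ℕ, f n ≤ 1 + π ^ 2 / 6 := by
    have : (fun n : ℕ => f n) = fun n : ℕ => (1 + (n : ℝ) ^ 2)⁻¹ := by
      funext n; simp only [hf, Int.cast_natCast]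
    rw [this]; exact tsum_inv_one_add_sq_nat_le
  have hB : ∑' n : ℕ, f (-((n : ℤ) + 1)) ≤ π ^ 2 / 6 := by
    have : (fun n : ℕ => f (-((n : ℤ) + 1))) = fun n : ℕ => (1 + ((n : ℝ) + 1) ^ 2)⁻¹ := by
      funext n; simp only [hf]; push_cast; ring
    rw [this]; exact tsum_inv_one_add_sq_nat_succ_le
  have hπ : π ^ 2 / 6 ≤ 7 / 4 := by nlinarith [Real.pi_lt_d2, Real.pi_pos]
  linarith

/-- `Σ_{k : Fin 2 → ℤ} ∏ᵢ (1+kᵢ²)⁻¹ = (Σ_{j∈ℤ} (1+j²)⁻¹)²` (the product trick in two coordinates). [cite: Grafakos2014, §3.3.3] -/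
theorem tsum_prod_inv_one_add_sq_fin_two_eq :
    ∑' k : Fin 2 → ℤ, ∏ i, (1 + (k i : ℝ) ^ 2)⁻¹ = (∑' j : ℤ, (1 + (j : ℝ) ^ 2)⁻¹) ^ 2 := by
  set w : ℤ → ℝ := fun j => (1 + (j : ℝ) ^ 2)⁻¹ with hw
  have hs : Summable w := summable_inv_one_add_sq_int
  have hw0 : 0 ≤ w := fun j => by simp only [hw]; positivity
  have hprod : Summable fun z : ℤ × ℤ => w z.1 * w z.2 := Summable.mul_of_nonneg hs hs hw0 hw0
  have hmul : (∑' j : ℤ, w j) * (∑' j : ℤ, w j) = ∑' z : ℤ × ℤ, w z.1 * w z.2 := hs.tsum_mul_tsum hs hprod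
  have he : ∑' k : Fin 2 → ℤ, ∏ i, (1 + (k i : ℝ) ^ 2)⁻¹ = ∑' z : ℤ × ℤ, w z.1 * w z.2 := by
    rw [← Equiv.tsum_eq (finTwoArrowEquiv ℤ).symm]
    refine tsum_congr fun z => ?_
    simp [hw, Fin.prod_univ_two, finTwoArrowEquiv, mul_comm]
  rw [he, ← hmul, sq]

/-- **`Σ_{k : Fin 2 → ℤ} ∏ᵢ (1+kᵢ²)⁻¹ ≤ 81/4`** — the lattice constant `C₂` of the two-dimensional aliasing / Fourier-tail bounds as a number.
[cite: Grafakos2014, §3.3.3] -/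
theorem tsum_prod_inv_one_add_sq_fin_two_le : ∑' k : Fin 2 → ℤ, ∏ i, (1 + (k i : ℝ) ^ 2)⁻¹ ≤ 81 / 4 := by
  rw [tsum_prod_inv_one_add_sq_fin_two_eq]
  have h := tsum_inv_one_add_sq_int_le
  have h0 : 0 ≤ ∑' j : ℤ, (1 + (j : ℝ) ^ 2)⁻¹ := tsum_nonneg fun j => by positivity
  nlinarith

end Torus

end Literature.Analysis.FunctionSpaces

end
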